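import Mathlib
import Summits.Schanuel.Schanuel.Theses.LogPatterns
import Literature.Barriers.Schanuel.AlgebraicIndependenceOfLogarithmsRankProofs

/-!
# Birth skeleton (BC3) for crux `LogSector` (item stmt-Schanuel-4310, route `LogPatterns`)

Seat `planner-skel-stmt-Schanuel-4310-0` (skeleton-register; route re-audit bin REPAIRABLE).
The crux `Summit.Schanuel.Schanuel.Theses.LogPatterns.LogSector` is the conjecture of algebraic
independence of `ℚ`-linearly independent logarithms of algebraic numbers
(= `Literature.Barriers.Schanuel.AlgIndepLogarithms` by `Iff.rfl`; Waldschmidt 2005 Conj. 1.1,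
Roy 1995 Conj. 1.1). It is concluded BY NAME below (`LogSector_of`, sorry-free composition;
`LogSector_proof`, the crux modulo exactly the three registered stubs).

LINE = Roy's own reduction of Conjecture 1.1 to rational translates of determinantal varieties
(D. Roy, *Points whose coordinates are logarithms of algebraic numbers on algebraic varieties*,
Acta Math. 175 (1995), §3.1: Proposition 3.3 p. 64 and the Remark p. 65 — "if Conjecture 1.1 is
true for all translates `A + M_{d,l}(r)` with `A ∈ M_{d,l}(ℚ)`, then it is true for all affine
algebraic varieties defined over `ℚ` and therefore it is true in general"), typed as affine
RATIONAL PENCILS `A₀ + Σₖ xₖ Aₖ` evaluated at logarithmic points, and split at the homogeneous /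
inhomogeneous seam the barrier catalogue records
(`Literature.Barriers.Schanuel.AlgebraicIndependenceOfLogarithms`, scope caveat "direction"):

* `stub_rankRepresentation` (PROVABLE NOW, size M) — Roy 1995 Prop. 3.3 for `R = ℚ` and the
  principal ideal `(P)`, read through the minors/rank dictionary of the tree
  (`Literature.Barriers.Schanuel.rank_le_of_det_submatrix_eq_zero`,
  `det_submatrix_eq_zero_of_rank_le`): every `P ∈ ℚ[X₁,…,Xₙ]` cuts out, on `ℂⁿ`, the rank
  condition `rank (A₀ + Σ xₖ Aₖ) ≤ r` of an affine pencil of rational matrices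
  (single-determinant form: Valiant 1979, universality of the determinant).
* `stub_royRankEqStructuralRank` (OPEN; Roy's "Conjecture 1.1 predicts `r = s`", §1 Remark (i)
  p. 54 = Conjecture 1.1 for the determinantal varieties `M_{d,l}(r)`; Waldschmidt 2005 Conj. 1.11
  on `𝓛`) — VERBATIM the consequent of the tree's named fact
  `Literature.Barriers.Schanuel.algIndepLogarithms_predicts_rank_eq_structuralRank`: every matrix
  with entries in `𝓛` has rank = structural rank. Known: `r ≤ s ≤ 2r`
  (`rank_le_structuralRank`, `roy1995_structuralRank_le_two_mul_rank`); implied by the crux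
  (calibration `royRankEqStructuralRank_of_logSector` below, from the tree's
  `algIndepLogarithms_predicts_rank_eq_structuralRank_holds`). The HOMOGENEOUS part of the crux.
* `stub_affineOfHomogeneous` (OPEN; Roy 1995 §3.1 Remark p. 65, the passage from `M_{d,l}(r)` to
  the rational translates `A + M_{d,l}(r)`; Waldschmidt 2005 §1, Conj. 1.11 ⟺ Conj. 1.1 only over
  `L̃ = ℚ̄ + ℚ̄𝓛`) — the INHOMOGENEOUS SUPPLEMENT: `r = s` on `𝓛` ⟹ a rational affine pencil attains
  its generic rank at every point of `𝓛ⁿ` with `ℚ`-linearly independent coordinates. Its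
  conclusion alone is implied by the crux (the `(r+1)`-minors of `A₀ + Σ Xₖ Aₖ` are polynomials
  over `ℚ`); no passage from the homogeneous statement is in print (`1 ∉ 𝓛`).
* `LogSector_of` — REAL PROOF (Roy's Remark p. 65 made formal): a relation `P(l) = 0` at a
  `ℚ`-linearly independent point `l ∈ 𝓛ⁿ` is a rank drop of a rational affine pencil at `l`
  (stub 1), impossible below the generic rank (stub 3 fed with stub 2), so `P` vanishes on `ℂⁿ`,
  so `P = 0` (`MvPolynomial.funext` over `ℂ` + injectivity of `MvPolynomial.map (algebraMap ℚ ℂ)`).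

Disproof used: none registered for stmt-Schanuel-4310 (`ledger crux ls` shows no `Disproof.lean`).
-/

noncomputable section

set_option linter.dupNamespace false

namespace Summit.Schanuel.Schanuel.Cruxes.LogSector.Birth

open Summit.Schanuel.Schanuel.Theses.LogPatterns (LogSector)
open Literature.Barriers.Schanuel (logQSpan structuralRank)

/-- STUB 1 (provable now, M): AFFINE DETERMINANTAL RANK REPRESENTATION of rational hypersurfaces —
for every `P ∈ ℚ[X₁,…,Xₙ]` there are integers `d, e, r` and rational matrices `A₀, A₁, …, Aₙ` of
size `d × e` such that, for all `x ∈ ℂⁿ`, `P(x) = 0 ↔ rank (A₀ + Σₖ xₖ Aₖ) ≤ r`.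
[Roy1995, §3.1 Proposition 3.3 p. 64 (R = ℚ, I = (P): I is generated by the (r+1)-minors of a
matrix with entries in ℚ + ℚX₁ + … + ℚXₙ)] [Valiant 1979, universality of the determinant]
[tree: `Literature.Barriers.Schanuel.rank_le_of_det_submatrix_eq_zero`,
`det_submatrix_eq_zero_of_rank_le`] -/
theorem stub_rankRepresentation :
    ∀ (n : ℕ) (P : MvPolynomial (Fin n) ℚ), ∃ (d e r : ℕ) (A₀ : Matrix (Fin d) (Fin e) ℚ)
      (A : Fin n → Matrix (Fin d) (Fin e) ℚ), ∀ x : Fin n → ℂ,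
        MvPolynomial.aeval x P = 0 ↔
          (A₀.map (algebraMap ℚ ℂ) + ∑ k, x k • (A k).map (algebraMap ℚ ℂ)).rank ≤ r := by
  sorry

/-- STUB 2 (open — the HOMOGENEOUS part; Roy's conjecture `r = s`): every matrix with entries in
`𝓛` (the `ℚ`-span of the logarithms of algebraic numbers, `logQSpan`) has rank equal to its
structural rank. Verbatim the consequent of the tree's named fact
`Literature.Barriers.Schanuel.algIndepLogarithms_predicts_rank_eq_structuralRank`; equivalently
Conjecture 1.1 for the determinantal varieties `M_{d,l}(r)`. Known unconditionally: `r ≤ s ≤ 2r`.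
[Roy1995, §1 Conjecture 1.1, Corollary 1.3 and Remark (i) p. 54; §3.1 Corollary 3.2 p. 63]
[Waldschmidt2005, §1 Conjecture 1.11] [Roy1992, §4 Corollary 1] -/
theorem stub_royRankEqStructuralRank :
    ∀ (d e : ℕ) (M : Matrix (Fin d) (Fin e) ℂ), (∀ i j, M i j ∈ logQSpan) →
      structuralRank M = M.rank := by
  sorry

/-- STUB 3 (open — the INHOMOGENEOUS SUPPLEMENT; Roy's passage from `M_{d,l}(r)` to the rational
translates `A + M_{d,l}(r)`): IF every matrix over `𝓛` has rank = structural rank, THEN every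
affine pencil of rational matrices `A₀ + Σₖ xₖ Aₖ` attains its generic (maximal) rank at every point
`l ∈ 𝓛ⁿ` with `ℚ`-linearly independent coordinates. (The conclusion is Conjecture 1.1 for all
translates `A + M_{d,l}(r)`, `A ∈ M_{d,l}(ℚ)`; it is implied by the crux; no derivation from the
homogeneous statement is in print, `1 ∉ 𝓛`.)
[Roy1995, §3.1 Remark p. 65] [Waldschmidt2005, §1 Conjecture 1.11 and the remark "as noted by
D. Roy … Conjecture 1.1 is equivalent to Conjecture 1.11" (over L̃ = ℚ̄ + ℚ̄𝓛 only)] -/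
theorem stub_affineOfHomogeneous :
    (∀ (d e : ℕ) (M : Matrix (Fin d) (Fin e) ℂ), (∀ i j, M i j ∈ logQSpan) →
        structuralRank M = M.rank) →
      ∀ (n d e : ℕ) (A₀ : Matrix (Fin d) (Fin e) ℚ) (A : Fin n → Matrix (Fin d) (Fin e) ℚ)
        (l : Fin n → ℂ), (∀ i, IsAlgebraic ℚ (Complex.exp (l i))) → LinearIndependent ℚ l →
          ∀ x : Fin n → ℂ,
            (A₀.map (algebraMap ℚ ℂ) + ∑ k, x k • (A k).map (algebraMap ℚ ℂ)).rank ≤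
              (A₀.map (algebraMap ℚ ℂ) + ∑ k, l k • (A k).map (algebraMap ℚ ℂ)).rank := by
  sorry

/-! ### Stub statements by name (so that the composition's hypotheses are the stubs BY NAME) -/

namespace Statement

/-- Statement of `stub_rankRepresentation`. -/
abbrev stub_rankRepresentation : Prop := type_of% @Birth.stub_rankRepresentation
/-- Statement of `stub_royRankEqStructuralRank`. -/
abbrev stub_royRankEqStructuralRank : Prop := type_of% @Birth.stub_royRankEqStructuralRank
/-- Statement of `stub_affineOfHomogeneous`. -/
abbrev stub_affineOfHomogeneous : Prop := type_of% @Birth.stub_affineOfHomogeneous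

end Statement

/-- COMPOSITION (kernel-checked, no sorry; Roy 1995 §3.1 Remark p. 65 made formal): a relation
`P(l) = 0` is a rank drop `rank (A₀ + Σ lₖ Aₖ) ≤ r` of a rational affine pencil at `l` (stub 1);
by stub 3 (fed with stub 2) the pencil's rank at any `x ∈ ℂⁿ` is at most its rank at `l`, so
`P(x) = 0` for all `x` (stub 1 backwards), so `P = 0` (`MvPolynomial.funext` over the infinite
field `ℂ` and injectivity of `MvPolynomial.map (algebraMap ℚ ℂ)`). -/
theorem LogSector_of (h₁ : Statement.stub_rankRepresentation)
    (h₂ : Statement.stub_royRankEqStructuralRank) (h₃ : Statement.stub_affineOfHomogeneous) :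
    LogSector := by
  intro n l halg hli
  rw [algebraicIndependent_iff]
  intro P hP
  obtain ⟨d, e, r, A₀, A, hA⟩ := h₁ n P
  have hl : (A₀.map (algebraMap ℚ ℂ) + ∑ k, l k • (A k).map (algebraMap ℚ ℂ)).rank ≤ r :=
    (hA l).1 hP
  have hall : ∀ x : Fin n → ℂ, MvPolynomial.aeval x P = 0 := fun x =>
    (hA x).2 (le_trans (h₃ h₂ n d e A₀ A l halg hli x) hl)
  have hmap : MvPolynomial.map (algebraMap ℚ ℂ) P = 0 := by
    apply MvPolynomial.funext
    intro x
    rw [MvPolynomial.eval_map, ← MvPolynomial.aeval_def, hall x, map_zero]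
  exact MvPolynomial.map_injective (algebraMap ℚ ℂ) (algebraMap ℚ ℂ).injective
    (hmap.trans (map_zero _).symm)

/-- The crux along this line MODULO exactly the three registered stubs (depends on `sorryAx` only
through `stub_*`). -/
theorem LogSector_proof : LogSector :=
  LogSector_of stub_rankRepresentation stub_royRankEqStructuralRank stub_affineOfHomogeneous

/-! ### Calibration (sorry-free): the open stubs are CONSEQUENCES of the crux -/

/-- Stub 2 follows from the crux: the tree's discharge of "Conjecture 1.1 predicts `r = s`"
(`LogSector` is `AlgIndepLogarithms` definitionally). [Roy1995, §1 Remark (i) p. 54] -/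
theorem royRankEqStructuralRank_of_logSector (h : LogSector) :
    Statement.stub_royRankEqStructuralRank := fun d e M hM =>
  Literature.Barriers.Schanuel.algIndepLogarithms_predicts_rank_eq_structuralRank_holds h d e M hM

end Summit.Schanuel.Schanuel.Cruxes.LogSector.Birth

end
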